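import Summits.NavierStokesRegularity.NavierStokesRegularity.Theorems.SelfMixingDichotomyCoherentScaleExclusionMixDriftStabilityLocalTools
import HarnessLib

/-!
# Crux `SelfMixingDichotomy.CoherentScaleExclusion` (stmt-NavierStokesRegularity-1423), line
  `registered`: STUB STAB-loc `stub_mixClass_driftStability_local` — localised stability of
  admissible passive scalars in the drift (whole space, MIX class)

Support file (`--supports stmt-NavierStokesRegularity-1423`, file 2/2) for the registered sub-goal
`stub_mixClass_driftStability_local` of the lead's skeleton
`Cruxes/CoherentScaleExclusion/Lines/birth.lean` (lead c3, wave 2: robustness of the MIX functional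
under perturbation of the drift). It is the LOCALISED version of the landed STAB stub
`stub_mixClass_driftStability` (`…MixDriftStability`): two jointly smooth, uniformly rapidly
decaying solutions `θ₁`, `θ₂` of `∂ₜθᵢ + ⟪uᵢ, ∇θᵢ⟫ = Δθᵢ` on `[a, b] × E` (one-sided time
derivative within `[a, b]`) from the same datum, in drifts whose slices are `C¹`, divergence free
and square integrable, satisfy `∫ (θ₁(t) − θ₂(t))² ≤ (Mi² Vi + Mo² Vo)(t − a)` whenever, for a
measurable set `D`, `|θ₂| ≤ Mi` on `[a, b] × D`, `|θ₂| ≤ Mo` on `[a, b] × Dᶜ`,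
`∫_D ‖u₁(s) − u₂(s)‖² ≤ Vi` and `∫_{Dᶜ} ‖u₁(s) − u₂(s)‖² ≤ Vo` at every time of the slab. (For
Navier–Stokes drifts `u₁ − u₂` is small only on a ball `D`; outside it the Gaussian tail of the
heat evolution `θ₂` absorbs the large far-field difference — hence the split.)

Proof: `mixDriftStabilityLocal_integral_sub_sq_le_of_production_le` is the time integration of
the energy method in abstract form — if the energy production `∫ 2 w(s) ∂ₜw(s)` of
`w = θ₁ − θ₂` is `≤ P` at every time of the slab then `∫ w(t)² ≤ P (t − a)` (`e(s) = ∫ w(s)²` is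
continuous on `[a, b]` with `e' = ∫ 2 w ∂ₜw` inside, by differentiation under the integral sign
dominated by the uniform decay bounds, as in `antitoneOn_integral_sq_of_transport`; then
`antitoneOn_of_deriv_nonpos` for `e(s) − P (s − a)`); the fixed-time bound with
`P = Mi² Vi + Mo² Vo` is `mixDriftStabilityLocal_production_le` (tools file
`…MixDriftStabilityLocalTools`).

References: C. J. P. Johansson, M. Sorella, arXiv:2409.03599 (2024), Lemma 2.2;
A. J. Majda, A. L. Bertozzi, *Vorticity and Incompressible Flow* (CUP 2002), §3.1.1.
-/

noncomputable section

open MeasureTheory Set Function Filter Topology InnerProductSpace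
open scoped ContDiff Laplacian InnerProductSpace RealInnerProductSpace

-- `Summit = Problem` for this summit; the tree lakefile sets `weak.linter.dupNamespace = false`.
set_option linter.dupNamespace false

namespace Summit.NavierStokesRegularity.NavierStokesRegularity.Theorems

open Literature.Analysis.FluidPDE

section General

variable {E : Type*} [NormedAddCommGroup E] [InnerProductSpace ℝ E] [FiniteDimensional ℝ E]
  [MeasurableSpace E] [BorelSpace E]

/-- **Energy integration for the difference of two admissible scalars (general space).** Let
`θ₁`, `θ₂` be jointly smooth with uniform rapid decay on `[a, b] × E`, `a < b`, with the same
datum `θ₁ a = θ₂ a`, and assume the energy production of `w = θ₁ − θ₂` is bounded at every time of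
the slab: `∫ 2 w(s) ∂ₜw(s) ≤ P` (`∂ₜ` the one-sided time derivative within `[a, b]`). Then
`∫ w(t)² ≤ P (t − a)` for every `t ∈ [a, b]`: `e(s) = ∫ w(s)²` is continuous on `[a, b]` and
differentiable on `(a, b)` with `e' = ∫ 2 w ∂ₜw` (differentiation under the integral sign
dominated by the uniform decay bounds of `θᵢ`, `∂ₜθᵢ`, as in
`antitoneOn_integral_sq_of_transport`), so `s ↦ e(s) − P (s − a)` is nonincreasing
(`antitoneOn_of_deriv_nonpos`) and vanishes at `s = a`. -/
theorem mixDriftStabilityLocal_integral_sub_sq_le_of_production_le {a b : ℝ} (hab : a < b)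
    {θ₁ θ₂ : ℝ → E → ℝ}
    (hθ₁ : IsSmoothSpaceTimeOn (Set.Icc a b) θ₁) (hd₁ : HasUniformRapidDecayOn (Set.Icc a b) θ₁)
    (hθ₂ : IsSmoothSpaceTimeOn (Set.Icc a b) θ₂) (hd₂ : HasUniformRapidDecayOn (Set.Icc a b) θ₂)
    (h0 : θ₁ a = θ₂ a) {P : ℝ}
    (hP : ∀ s ∈ Set.Icc a b, ∫ x, 2 * ((θ₁ s x - θ₂ s x) *
      (timeDerivWithin (Set.Icc a b) θ₁ s x - timeDerivWithin (Set.Icc a b) θ₂ s x)) ≤ P)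
    {t : ℝ} (ht : t ∈ Set.Icc a b) :
    ∫ x, (θ₁ t x - θ₂ t x) ^ 2 ≤ P * (t - a) := by
  set S : Set ℝ := Icc a b with hS_def
  have hS : UniqueDiffOn ℝ S := uniqueDiffOn_Icc hab
  -- decay exponent and uniform decay constants for `θᵢ`, `∂ₜθᵢ`
  set K : ℕ := Module.finrank ℝ E + 1 with hK
  have hr1 : (Module.finrank ℝ E : ℝ) < (K : ℝ) := by rw [hK]; push_cast; linarith
  have hK0 : (0 : ℝ) ≤ (K : ℝ) := Nat.cast_nonneg _
  obtain ⟨A0, hA0, hA0b⟩ := hd₁.norm_le_rpow K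
  obtain ⟨A3, hA3, hA3b⟩ := hd₁.norm_timeDerivWithin_le_rpow hθ₁ hS K
  obtain ⟨B0, hB0, hB0b⟩ := hd₂.norm_le_rpow K
  obtain ⟨B3, hB3, hB3b⟩ := hd₂.norm_timeDerivWithin_le_rpow hθ₂ hS K
  set C : ℝ := A0 + A3 + B0 + B3 with hC_def
  have hC : 0 ≤ C := by rw [hC_def]; positivity
  have h10 : ∀ s ∈ S, ∀ x, ‖θ₁ s x‖ ≤ C * (1 + ‖x‖) ^ (-(K : ℝ)) := fun s hs x =>
    le_decay_of_le_decay x (hA0b s hs x) (by rw [hC_def]; linarith)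
  have h13 : ∀ s ∈ S, ∀ x, ‖timeDerivWithin S θ₁ s x‖ ≤ C * (1 + ‖x‖) ^ (-(K : ℝ)) :=
    fun s hs x => le_decay_of_le_decay x (hA3b s hs x) (by rw [hC_def]; linarith)
  have h20 : ∀ s ∈ S, ∀ x, ‖θ₂ s x‖ ≤ C * (1 + ‖x‖) ^ (-(K : ℝ)) := fun s hs x =>
    le_decay_of_le_decay x (hB0b s hs x) (by rw [hC_def]; linarith)
  have h23 : ∀ s ∈ S, ∀ x, ‖timeDerivWithin S θ₂ s x‖ ≤ C * (1 + ‖x‖) ^ (-(K : ℝ)) :=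
    fun s hs x => le_decay_of_le_decay x (hB3b s hs x) (by rw [hC_def]; linarith)
  -- the difference, its energy and the energy production
  set w : ℝ → E → ℝ := fun s x => θ₁ s x - θ₂ s x with hw_def
  set w' : ℝ → E → ℝ := fun s x => timeDerivWithin S θ₁ s x - timeDerivWithin S θ₂ s x
    with hw'_def
  set e : ℝ → ℝ := fun s => ∫ x, (w s x) ^ 2 with he_def
  set φ : ℝ → ℝ := fun s => ∫ x, 2 * (w s x * w' s x) with hφ_def
  have h2C : 0 ≤ 2 * C := by positivity
  have hw0 : ∀ s ∈ S, ∀ x, ‖w s x‖ ≤ 2 * C * (1 + ‖x‖) ^ (-(K : ℝ)) := fun s hs x => by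
    refine (norm_sub_le _ _).trans ?_
    have := h10 s hs x; have := h20 s hs x; linarith
  have hwt : ∀ s ∈ S, ∀ x, ‖w' s x‖ ≤ 2 * C * (1 + ‖x‖) ^ (-(K : ℝ)) := fun s hs x => by
    refine (norm_sub_le _ _).trans ?_
    have := h13 s hs x; have := h23 s hs x; linarith
  -- continuity in `x` at fixed time, in `t` at fixed `x`
  have hwc : ∀ s ∈ S, Continuous (w s) := fun s hs =>
    (hθ₁.continuous_slice hs).sub (hθ₂.continuous_slice hs)
  have hw'c : ∀ s ∈ S, Continuous (w' s) := fun s hs =>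
    (hθ₁.continuous_timeDerivWithin hS hs).sub (hθ₂.continuous_timeDerivWithin hS hs)
  have hwt_c : ∀ x, ContinuousOn (fun s => w s x) S := fun x =>
    (hθ₁.continuousOn_time x).sub (hθ₂.continuousOn_time x)
  -- the dominating function
  set bound : E → ℝ := fun x => 2 * (2 * C) * (2 * C) * (1 + ‖x‖) ^ (-(K : ℝ)) with hbound_def
  have hbound : Integrable bound (volume : Measure E) := by
    have := (integrable_one_add_norm (E := E) (μ := volume) hr1).const_mul (2 * (2 * C) * (2 * C))
    simpa [hbound_def] using this
  have hFle : ∀ s ∈ S, ∀ x, ‖(w s x) ^ 2‖ ≤ bound x := by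
    intro s hs x
    rw [norm_pow, sq, hbound_def]
    calc ‖w s x‖ * ‖w s x‖
        ≤ 2 * C * (1 + ‖x‖) ^ (-(K : ℝ)) * (2 * C * (1 + ‖x‖) ^ (-(K : ℝ))) :=
          mul_le_mul (hw0 s hs x) (hw0 s hs x) (norm_nonneg _) (by positivity)
      _ ≤ 2 * C * 1 * (2 * C * (1 + ‖x‖) ^ (-(K : ℝ))) := by
          gcongr; exact rpow_neg_le_one x hK0
      _ ≤ 2 * (2 * C) * (2 * C) * (1 + ‖x‖) ^ (-(K : ℝ)) := by
          have : 0 ≤ 2 * C * (2 * C) * (1 + ‖x‖) ^ (-(K : ℝ)) := by positivity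
          nlinarith
  have hF'le : ∀ s ∈ S, ∀ x, ‖2 * (w s x * w' s x)‖ ≤ bound x := by
    intro s hs x
    rw [norm_mul, Real.norm_two, norm_mul, hbound_def]
    calc 2 * (‖w s x‖ * ‖w' s x‖)
        ≤ 2 * (2 * C * (1 + ‖x‖) ^ (-(K : ℝ)) * (2 * C * (1 + ‖x‖) ^ (-(K : ℝ)))) :=
          mul_le_mul_of_nonneg_left
            (mul_le_mul (hw0 s hs x) (hwt s hs x) (norm_nonneg _) (by positivity)) (by norm_num)
      _ ≤ 2 * (2 * C * 1 * (2 * C * (1 + ‖x‖) ^ (-(K : ℝ)))) := by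
          gcongr; exact rpow_neg_le_one x hK0
      _ = 2 * (2 * C) * (2 * C) * (1 + ‖x‖) ^ (-(K : ℝ)) := by ring
  have hIe : ∀ s ∈ S, Integrable (fun x => (w s x) ^ 2) (volume : Measure E) := fun s hs =>
    Integrable.mono' hbound ((hwc s hs).pow 2).aestronglyMeasurable
      (Eventually.of_forall (hFle s hs))
  -- (B1) the energy is continuous on `[a, b]`
  have hB1 : ContinuousOn e S := by
    refine continuousOn_of_dominated (bound := bound) (fun s hs => ?_) (fun s hs => ?_) hbound ?_
    · exact ((hwc s hs).pow 2).aestronglyMeasurable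
    · exact Eventually.of_forall (hFle s hs)
    · exact Eventually.of_forall fun x => (hwt_c x).pow 2
  -- (B2) the energy is differentiable on `(a, b)` with derivative `φ`
  have hB2 : ∀ s ∈ Ioo a b, HasDerivAt e (φ s) s := by
    intro s hs
    have hsS : s ∈ S := Ioo_subset_Icc_self hs
    have hIoo : Ioo a b ∈ 𝓝 s := Ioo_mem_nhds hs.1 hs.2
    have key := hasDerivAt_integral_of_dominated_loc_of_deriv_le (μ := (volume : Measure E))
      (F := fun σ x => (w σ x) ^ 2) (F' := fun σ x => 2 * (w σ x * w' σ x)) (x₀ := s)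
      (bound := bound) hIoo ?_ (hIe s hsS) ?_ ?_ hbound ?_
    · exact key.2
    · filter_upwards [hIoo] with σ hσ
      exact ((hwc σ (Ioo_subset_Icc_self hσ)).pow 2).aestronglyMeasurable
    · exact (continuous_const.mul ((hwc s hsS).mul (hw'c s hsS))).aestronglyMeasurable
    · exact Eventually.of_forall fun x σ hσ => hF'le σ (Ioo_subset_Icc_self hσ) x
    · refine Eventually.of_forall fun x σ hσ => ?_
      have hσS : σ ∈ S := Ioo_subset_Icc_self hσ
      have hSσ : S ∈ 𝓝 σ := Icc_mem_nhds hσ.1 hσ.2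
      have h1 : HasDerivAt (fun τ => θ₁ τ x) (timeDerivWithin S θ₁ σ x) σ :=
        (hθ₁.hasDerivWithinAt_timeDerivWithin hS hσS x).hasDerivAt hSσ
      have h2 : HasDerivAt (fun τ => θ₂ τ x) (timeDerivWithin S θ₂ σ x) σ :=
        (hθ₂.hasDerivWithinAt_timeDerivWithin hS hσS x).hasDerivAt hSσ
      have h12 : HasDerivAt (fun τ => w τ x) (w' σ x) σ := h1.sub h2
      have hfeq : (fun τ => w τ x ^ 2) = fun τ => w τ x * w τ x := funext fun τ => sq _
      show HasDerivAt (fun τ => w τ x ^ 2) (2 * (w σ x * w' σ x)) σ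
      rw [hfeq]
      exact (h12.fun_mul h12).congr_deriv (by ring)
  -- (B3) the energy production is at most `P` on `[a, b]` (hypothesis)
  have hB3 : ∀ s ∈ S, φ s ≤ P := fun s hs => hP s hs
  -- integrate: `g(s) = e(s) - P (s - a)` is nonincreasing on `[a, b]` and vanishes at `a`
  set g : ℝ → ℝ := fun s => e s - P * (s - a) with hg_def
  have hgd : ∀ s ∈ Ioo a b, HasDerivAt g (φ s - P * 1) s := fun s hs =>
    (hB2 s hs).sub (((hasDerivAt_id s).sub_const a).const_mul P)
  have hanti : AntitoneOn g S := by
    refine antitoneOn_of_deriv_nonpos (convex_Icc a b) ?_ ?_ ?_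
    · exact hB1.sub ((continuous_const.mul (continuous_id.sub continuous_const)).continuousOn)
    · rw [interior_Icc]
      exact fun s hs => (hgd s hs).differentiableAt.differentiableWithinAt
    · rw [interior_Icc]
      intro s hs
      rw [(hgd s hs).deriv]
      have h3 := hB3 s (Ioo_subset_Icc_self hs)
      linarith
  have haS : a ∈ S := left_mem_Icc.2 hab.le
  have he0 : e a = 0 := by simp [he_def, hw_def, h0]
  have hga : g a = 0 := by simp [hg_def, he0]
  have hgt : g t ≤ g a := hanti haS ht ht.1
  rw [hga] at hgt
  have hgt' : e t - P * (t - a) ≤ 0 := hgt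
  show e t ≤ P * (t - a)
  linarith

/-- **Localised stability of admissible passive scalars in the drift (general space).** Let `θ₁`,
`θ₂` be jointly smooth with uniform rapid decay on `[a, b] × E`, `a < b`, solving
`∂ₜθᵢ + ⟪uᵢ, ∇θᵢ⟫ = Δθᵢ` there (one-sided time derivative within `[a, b]`) with the same datum
`θ₁ a = θ₂ a`, the drifts being `C¹`, divergence free and square integrable at each time of the
slab; let `D` be measurable with `|θ₂| ≤ Mi` on `[a, b] × D`, `|θ₂| ≤ Mo` on `[a, b] × Dᶜ`,
`∫_D ‖u₁(s) − u₂(s)‖² ≤ Vi` and `∫_{Dᶜ} ‖u₁(s) − u₂(s)‖² ≤ Vo` at every time of the slab. Then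
`∫ (θ₁(t) − θ₂(t))² ≤ (Mi² Vi + Mo² Vo)(t − a)` for every `t ∈ [a, b]`
(`mixDriftStabilityLocal_production_le` at each time, then
`mixDriftStabilityLocal_integral_sub_sq_le_of_production_le`). -/
theorem mixDriftStabilityLocal_integral_sub_sq_le {a b : ℝ} (hab : a < b)
    {u₁ u₂ : ℝ → E → E} {θ₁ θ₂ : ℝ → E → ℝ} {D : Set E} (hD : MeasurableSet D)
    (hθ₁ : IsSmoothSpaceTimeOn (Set.Icc a b) θ₁) (hd₁ : HasUniformRapidDecayOn (Set.Icc a b) θ₁)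
    (he₁ : ∀ t ∈ Set.Icc a b, ∀ x,
      timeDerivWithin (Set.Icc a b) θ₁ t x + ⟪u₁ t x, gradient (θ₁ t) x⟫ = (Δ (θ₁ t)) x)
    (hθ₂ : IsSmoothSpaceTimeOn (Set.Icc a b) θ₂) (hd₂ : HasUniformRapidDecayOn (Set.Icc a b) θ₂)
    (he₂ : ∀ t ∈ Set.Icc a b, ∀ x,
      timeDerivWithin (Set.Icc a b) θ₂ t x + ⟪u₂ t x, gradient (θ₂ t) x⟫ = (Δ (θ₂ t)) x)
    (hu₁ : ∀ t ∈ Set.Icc a b, ContDiff ℝ 1 (u₁ t))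
    (hdiv₁ : ∀ t ∈ Set.Icc a b, VectorCalculus.IsDivFree (u₁ t))
    (hL₁ : ∀ t ∈ Set.Icc a b, MemLp (u₁ t) 2 (volume : Measure E))
    (hu₂ : ∀ t ∈ Set.Icc a b, ContDiff ℝ 1 (u₂ t))
    (hdiv₂ : ∀ t ∈ Set.Icc a b, VectorCalculus.IsDivFree (u₂ t))
    (hL₂ : ∀ t ∈ Set.Icc a b, MemLp (u₂ t) 2 (volume : Measure E))
    (h0 : θ₁ a = θ₂ a) {Mi Mo Vi Vo : ℝ}
    (hMi : ∀ t ∈ Set.Icc a b, ∀ x ∈ D, |θ₂ t x| ≤ Mi)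
    (hMo : ∀ t ∈ Set.Icc a b, ∀ x ∈ Dᶜ, |θ₂ t x| ≤ Mo)
    (hVi : ∀ t ∈ Set.Icc a b, ∫ x in D, ‖u₁ t x - u₂ t x‖ ^ 2 ≤ Vi)
    (hVo : ∀ t ∈ Set.Icc a b, ∫ x in Dᶜ, ‖u₁ t x - u₂ t x‖ ^ 2 ≤ Vo)
    {t : ℝ} (ht : t ∈ Set.Icc a b) :
    ∫ x, (θ₁ t x - θ₂ t x) ^ 2 ≤ (Mi ^ 2 * Vi + Mo ^ 2 * Vo) * (t - a) := by
  have hS : UniqueDiffOn ℝ (Icc a b) := uniqueDiffOn_Icc hab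
  -- decay exponent and uniform decay constants for `θᵢ`, `Dθᵢ`, `D²θᵢ`
  set K : ℕ := Module.finrank ℝ E + 1 with hK
  have hr1 : (Module.finrank ℝ E : ℝ) < (K : ℝ) := by rw [hK]; push_cast; linarith
  obtain ⟨A0, hA0, hA0b⟩ := hd₁.norm_le_rpow K
  obtain ⟨A1, hA1, hA1b⟩ := hd₁.norm_fderiv_le_rpow hθ₁ hS K
  obtain ⟨A2, hA2, hA2b⟩ := hd₁.norm_fderiv_fderiv_le_rpow hθ₁ hS K
  obtain ⟨B0, hB0, hB0b⟩ := hd₂.norm_le_rpow K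
  obtain ⟨B1, hB1, hB1b⟩ := hd₂.norm_fderiv_le_rpow hθ₂ hS K
  obtain ⟨B2, hB2, hB2b⟩ := hd₂.norm_fderiv_fderiv_le_rpow hθ₂ hS K
  set C : ℝ := A0 + A1 + A2 + B0 + B1 + B2 with hC_def
  have hC : 0 ≤ C := by rw [hC_def]; positivity
  have h10 : ∀ s ∈ Icc a b, ∀ x, ‖θ₁ s x‖ ≤ C * (1 + ‖x‖) ^ (-(K : ℝ)) := fun s hs x =>
    le_decay_of_le_decay x (hA0b s hs x) (by rw [hC_def]; linarith)
  have h11 : ∀ s ∈ Icc a b, ∀ x, ‖fderiv ℝ (θ₁ s) x‖ ≤ C * (1 + ‖x‖) ^ (-(K : ℝ)) :=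
    fun s hs x => le_decay_of_le_decay x (hA1b s hs x) (by rw [hC_def]; linarith)
  have h12 : ∀ s ∈ Icc a b, ∀ x, ‖fderiv ℝ (fderiv ℝ (θ₁ s)) x‖ ≤ C * (1 + ‖x‖) ^ (-(K : ℝ)) :=
    fun s hs x => le_decay_of_le_decay x (hA2b s hs x) (by rw [hC_def]; linarith)
  have h20 : ∀ s ∈ Icc a b, ∀ x, ‖θ₂ s x‖ ≤ C * (1 + ‖x‖) ^ (-(K : ℝ)) := fun s hs x =>
    le_decay_of_le_decay x (hB0b s hs x) (by rw [hC_def]; linarith)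
  have h21 : ∀ s ∈ Icc a b, ∀ x, ‖fderiv ℝ (θ₂ s) x‖ ≤ C * (1 + ‖x‖) ^ (-(K : ℝ)) :=
    fun s hs x => le_decay_of_le_decay x (hB1b s hs x) (by rw [hC_def]; linarith)
  have h22 : ∀ s ∈ Icc a b, ∀ x, ‖fderiv ℝ (fderiv ℝ (θ₂ s)) x‖ ≤ C * (1 + ‖x‖) ^ (-(K : ℝ)) :=
    fun s hs x => le_decay_of_le_decay x (hB2b s hs x) (by rw [hC_def]; linarith)
  refine mixDriftStabilityLocal_integral_sub_sq_le_of_production_le hab hθ₁ hd₁ hθ₂ hd₂ h0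
    (fun s hs => ?_) ht
  have hθ₁2 : ContDiff ℝ 2 (θ₁ s) := contDiff_infty.1 (hθ₁.contDiff_slice hs) 2
  have hθ₂2 : ContDiff ℝ 2 (θ₂ s) := contDiff_infty.1 (hθ₂.contDiff_slice hs) 2
  have key := mixDriftStabilityLocal_production_le hD hθ₁2 hθ₂2 (he₁ s hs) (he₂ s hs) (hu₁ s hs)
    (hdiv₁ s hs) (hL₁ s hs) (hu₂ s hs) (hdiv₂ s hs) (hL₂ s hs) hC hr1 (h10 s hs) (h11 s hs)
    (h12 s hs) (h20 s hs) (h21 s hs) (h22 s hs) (hMi s hs) (hMo s hs)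
  have h1 : Mi ^ 2 * ∫ x in D, ‖u₁ s x - u₂ s x‖ ^ 2 ≤ Mi ^ 2 * Vi :=
    mul_le_mul_of_nonneg_left (hVi s hs) (sq_nonneg _)
  have h2 : Mo ^ 2 * ∫ x in Dᶜ, ‖u₁ s x - u₂ s x‖ ^ 2 ≤ Mo ^ 2 * Vo :=
    mul_le_mul_of_nonneg_left (hVo s hs) (sq_nonneg _)
  linarith

end General

/-- **STAB-loc — localised stability of admissible passive scalars in the drift (whole-space,
MIX-class form of Johansson–Sorella 2024, Lemma 2.2, with the cross term split over a measurable
set `D` and its complement; registered sub-goal `stub_mixClass_driftStability_local` of the crux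
`CoherentScaleExclusion`, line `registered`, lead c3).** Two jointly smooth, uniformly rapidly
decaying solutions `θ₁, θ₂` of `∂ₜθᵢ + ⟪uᵢ, ∇θᵢ⟫ = Δθᵢ` on `[a, b] × ℝ³` from the same datum, in
drifts whose slices are `C¹`, divergence free and square integrable, satisfy
`∫ (θ₁(t) − θ₂(t))² ≤ (Mi² Vi + Mo² Vo)(t − a)` whenever `|θ₂| ≤ Mi` on `[a, b] × D`,
`|θ₂| ≤ Mo` on `[a, b] × Dᶜ`, `∫_D ‖u₁(s) − u₂(s)‖² ≤ Vi` and `∫_{Dᶜ} ‖u₁(s) − u₂(s)‖² ≤ Vo` at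
every time of the slab (`mixDriftStabilityLocal_integral_sub_sq_le` on `E = ℝ³`; the sign
hypotheses on `Mi`, `Mo` are not needed). -/
theorem stub_mixClass_driftStability_local :
    ∀ (a b : ℝ), a < b →
      ∀ (u₁ u₂ : ℝ → EuclideanSpace ℝ (Fin 3) → EuclideanSpace ℝ (Fin 3))
        (θ₁ θ₂ : ℝ → EuclideanSpace ℝ (Fin 3) → ℝ) (D : Set (EuclideanSpace ℝ (Fin 3))),
        MeasurableSet D →
      IsSmoothSpaceTimeOn (Set.Icc a b) θ₁ → HasUniformRapidDecayOn (Set.Icc a b) θ₁ →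
      (∀ t ∈ Set.Icc a b, ∀ x : EuclideanSpace ℝ (Fin 3),
        timeDerivWithin (Set.Icc a b) θ₁ t x + inner ℝ (u₁ t x) (gradient (θ₁ t) x) =
          Laplacian.laplacian (θ₁ t) x) →
      IsSmoothSpaceTimeOn (Set.Icc a b) θ₂ → HasUniformRapidDecayOn (Set.Icc a b) θ₂ →
      (∀ t ∈ Set.Icc a b, ∀ x : EuclideanSpace ℝ (Fin 3),
        timeDerivWithin (Set.Icc a b) θ₂ t x + inner ℝ (u₂ t x) (gradient (θ₂ t) x) =
          Laplacian.laplacian (θ₂ t) x) →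
      (∀ t ∈ Set.Icc a b, ContDiff ℝ 1 (u₁ t)) →
      (∀ t ∈ Set.Icc a b, Literature.Analysis.FluidPDE.VectorCalculus.IsDivFree (u₁ t)) →
      (∀ t ∈ Set.Icc a b, MeasureTheory.MemLp (u₁ t) 2 MeasureTheory.volume) →
      (∀ t ∈ Set.Icc a b, ContDiff ℝ 1 (u₂ t)) →
      (∀ t ∈ Set.Icc a b, Literature.Analysis.FluidPDE.VectorCalculus.IsDivFree (u₂ t)) →
      (∀ t ∈ Set.Icc a b, MeasureTheory.MemLp (u₂ t) 2 MeasureTheory.volume) →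
      θ₁ a = θ₂ a →
      ∀ (Mi Mo Vi Vo : ℝ), 0 ≤ Mi → 0 ≤ Mo →
      (∀ t ∈ Set.Icc a b, ∀ x ∈ D, |θ₂ t x| ≤ Mi) →
      (∀ t ∈ Set.Icc a b, ∀ x ∈ Dᶜ, |θ₂ t x| ≤ Mo) →
      (∀ t ∈ Set.Icc a b, ∫ x in D, ‖u₁ t x - u₂ t x‖ ^ 2 ≤ Vi) →
      (∀ t ∈ Set.Icc a b, ∫ x in Dᶜ, ‖u₁ t x - u₂ t x‖ ^ 2 ≤ Vo) →
      ∀ t ∈ Set.Icc a b, ∫ x, (θ₁ t x - θ₂ t x) ^ 2 ≤ (Mi ^ 2 * Vi + Mo ^ 2 * Vo) * (t - a) := by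
  intro a b hab u₁ u₂ θ₁ θ₂ D hD hθ₁ hd₁ he₁ hθ₂ hd₂ he₂ hu₁ hdiv₁ hL₁ hu₂ hdiv₂ hL₂ h0 Mi Mo Vi Vo
    _ _ hMi hMo hVi hVo t ht
  exact mixDriftStabilityLocal_integral_sub_sq_le hab hD hθ₁ hd₁ he₁ hθ₂ hd₂ he₂ hu₁ hdiv₁ hL₁ hu₂
    hdiv₂ hL₂ h0 hMi hMo hVi hVo ht

end Summit.NavierStokesRegularity.NavierStokesRegularity.Theorems

end
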